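import Summits.BirchSwinnertonDyer.BirchSwinnertonDyer.Theses.PAdicOrderV2
import Literature.NumberTheory.EllipticCurves.OrdinaryPrimesProofs

/-!
# BirchSwinnertonDyer / PAdicOrderV2 — the glue `CruxesToThesis`

Route `BirchSwinnertonDyer/PAdicOrderV2`, support item `stmt-BirchSwinnertonDyer-14877`
(`Summit.BirchSwinnertonDyer.BirchSwinnertonDyer.Theses.PAdicOrderV2.CruxesToThesis`):

  (∀ W elliptic with `NeZero (W.conductorNorm ℤ)`, ∃ f ∈ S₂(Γ₀(N_W)) newform of W)   -- modularity, inlined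
    → `PAdicOrderComparisonR2` (crux #2: ord_T L_p(f,α_p,T) = r_an at every good ordinary p)
    → `PAdicOrderPadicBSDrankR2` (crux #3: ord_T L_p(f,α_p,T) = r_MW at every good ordinary p)
    → `PAdicOrderThesisR2` (thesis X: ∃ good ordinary p, ∃ newform f, both equalities).

Pure logic plus two PROVED Literature theorems: every elliptic `E/ℚ` (globally minimal `W`) has
a good ordinary prime `p ≥ 5` (`WeierstrassCurve.exists_good_ordinary_prime_holds`,
`OrdinaryPrimesProofs.lean`), and `0 < N_W` (`WeierstrassCurve.conductorNorm_pos_holds`), which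
supplies the instance `NeZero (W.conductorNorm ℤ)` needed to fire the modularity antecedent.
`IsOrdinaryAt W p` is by definition `W.HasGoodReductionAtPrime p ∧ ¬ (p : ℤ) ∣ W.frobeniusTrace p`
(`isOrdinaryAt_iff`, `Iff.rfl`). The theorem is unconditional as an implication: modularity is a
HYPOTHESIS of the item, not a named constant used in the proof.
-/

-- `Summit.<Summit>.<Problem>` is the mandated namespace; for the single-conjunct summit
-- BirchSwinnertonDyer the duplicate `BirchSwinnertonDyer.BirchSwinnertonDyer` is deliberate.
set_option linter.dupNamespace false

namespace Summit.BirchSwinnertonDyer.BirchSwinnertonDyer.Theorems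

open Summit.BirchSwinnertonDyer.BirchSwinnertonDyer.Theses.PAdicOrderV2

/-- Settles `stmt-BirchSwinnertonDyer-14877` (support `CruxesToThesis` of route PAdicOrderV2):
modularity (inlined antecedent) → crux #2 `PAdicOrderComparisonR2` → crux #3
`PAdicOrderPadicBSDrankR2` → thesis `PAdicOrderThesisR2`. Proof: for a globally minimal elliptic
`W`, take a good ordinary prime `p` from `WeierstrassCurve.exists_good_ordinary_prime_holds`, the
instance `NeZero (W.conductorNorm ℤ)` from `WeierstrassCurve.conductorNorm_pos_holds`, the newform
`f` of level `N_W` from the antecedent, and apply both cruxes at `(W, p, f)`. [folklore] -/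
theorem padicOrderV2_cruxesToThesis_proof :
    Summit.BirchSwinnertonDyer.BirchSwinnertonDyer.Theses.PAdicOrderV2.CruxesToThesis := by
  unfold CruxesToThesis
  intro hmod h2 h3 W _ _
  obtain ⟨p, hp, -, hgood, hord⟩ := WeierstrassCurve.exists_good_ordinary_prime_holds W
  haveI hN : NeZero (W.conductorNorm ℤ) := ⟨(W.conductorNorm_pos_holds).ne'⟩
  obtain ⟨f, hf⟩ := hmod W
  have hO : Literature.NumberTheory.EllipticCurves.IsOrdinaryAt W p := ⟨hgood, hord⟩
  exact ⟨p, hp, hO, W.conductorNorm ℤ, hN, f, hf, h2 W p hO f hf, h3 W p hO f hf⟩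

end Summit.BirchSwinnertonDyer.BirchSwinnertonDyer.Theorems
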